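import Mathlib.Analysis.InnerProductSpace.Calculus
import Literature.Geometry.Lorentzian.ScalarCurvatureIntegrable
import Literature.Geometry.Lorentzian.AsymptoticallyFlatChart
import Literature.Geometry.Lorentzian.AsymptoticFlatnessProofs
import HarnessLib

/-!
# Radial cut-offs `χ(r/ρ)` on a one-ended asymptotically flat manifold

Support file (all results proved, no definitions, no named facts) for the flux computation of
the mass term in Schoen–Yau's Lemma 3.2 (Comm. Math. Phys. 65 (1979), (3.16):
`A = −(1/4π) ∫_N (fv + h) √g dx`, i.e. `∫_N Δv dV = −4πA` for `v = A/r + ω`): the integral of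
`Δ_h v` over `N` is the limit of `∫_N χ_ρ Δ_h v dV = −∫_N ⟨dχ_ρ, dv⟩_h dV` for the radial
cut-offs `χ_ρ(q) = χ(‖coord q‖/ρ)`, `ρ → ∞`, where `χ : ℝ → ℝ` is any smooth profile with
`χ = 1` on `(−∞, 1]` and `χ = 0` on `[2, ∞)` (e.g. `1 − Real.smoothTransition (s − 1)`,
`exists_radialProfile`). Everything is stated for an arbitrary such profile `χ`:

* on `ℝ³`: `contDiff_radialProfile_norm_div` (`y ↦ χ(‖y‖/ρ)` is smooth, being `1` near the
  origin), `fderiv_radialProfile_norm_div` (`D(χ(‖·‖/ρ))(y) w = χ'(‖y‖/ρ) ρ⁻¹ ⟪y, w⟫/‖y‖`),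
  `exists_bound_deriv_radialProfile` (`|χ'| ≤ C₁`), `norm_fderiv_radialProfile_norm_div_le`
  (`‖D(χ(‖·‖/ρ))(y)‖ ≤ C₁/ρ`), and the vanishing of the derivative off the annulus
  `ρ ≤ ‖y‖ ≤ 2ρ`;
* on `X`: `AFEnd.contMDiff_radialCutoff` (smoothness of `q ↦ χ(‖coord q‖/ρ)` for `ρ > R`),
  `radialCutoff_eq_one`, `radialCutoff_eq_zero_of_mem_far`, `hasCompactSupport_radialCutoff`
  (one end), `radialCutoff_eventuallyEq_one` and `mvfderiv_radialCutoff_eq_zero` off the closed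
  far piece `{ρ ≤ ‖coord‖}`, `endValue_radialCutoff` (`χ_ρ ∘ Φ = χ(‖·‖/ρ)`), and
  `eventually_radialCutoff_eq_one` (`χ_ρ(q) = 1` for `ρ` large, each `q`).

## References

* R. Schoen, S.-T. Yau, *On the proof of the positive mass conjecture in general relativity*,
  Comm. Math. Phys. 65 (1979) 45–76, proof of Lemma 3.2, (3.16).
* R. Bartnik, *The mass of an asymptotically flat manifold*, CPAM 39 (1986), §4 (cut-off
  arguments on the end).
-/

noncomputable section

open Bundle Set Function Filter Manifold Metric TopologicalSpace Bornology
open scoped Manifold ContDiff Topology RealInnerProductSpace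

namespace Literature.Geometry.Lorentzian

/-! ### Radial profiles on `ℝ³` -/

section Profile

variable {χ : ℝ → ℝ} (hχ : ContDiff ℝ ∞ χ) (h1 : ∀ s, s ≤ 1 → χ s = 1) (h2 : ∀ s, 2 ≤ s → χ s = 0)

/-- **A smooth radial profile exists**: `χ(s) = 1 − S(s − 1)` with `S = Real.smoothTransition`
is smooth, equals `1` on `(−∞, 1]`, `0` on `[2, ∞)`, and takes values in `[0, 1]`. [folklore] -/
theorem exists_radialProfile : ∃ χ : ℝ → ℝ, ContDiff ℝ ∞ χ ∧ (∀ s, s ≤ 1 → χ s = 1) ∧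
    (∀ s, 2 ≤ s → χ s = 0) ∧ ∀ s, |χ s| ≤ 1 := by
  refine ⟨fun s ↦ 1 - Real.smoothTransition (s - 1), ?_, fun s hs ↦ ?_, fun s hs ↦ ?_,
    fun s ↦ ?_⟩
  · exact contDiff_const.sub (Real.smoothTransition.contDiff.comp (contDiff_id.sub contDiff_const))
  · change 1 - Real.smoothTransition (s - 1) = 1
    rw [Real.smoothTransition.zero_of_nonpos (by linarith), sub_zero]
  · change 1 - Real.smoothTransition (s - 1) = 0
    rw [Real.smoothTransition.one_of_one_le (by linarith), sub_self]
  · change |1 - Real.smoothTransition (s - 1)| ≤ 1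
    have h0 := Real.smoothTransition.nonneg (s - 1)
    have h1 := Real.smoothTransition.le_one (s - 1)
    rw [abs_le]
    constructor <;> linarith

include h1 in
/-- The derivative of a radial profile vanishes on `(−∞, 1)` (where it is constant). [folklore] -/
theorem deriv_radialProfile_eq_zero_of_lt_one {s : ℝ} (hs : s < 1) : deriv χ s = 0 := by
  have hev : χ =ᶠ[𝓝 s] fun _ ↦ 1 := by
    filter_upwards [Iio_mem_nhds hs] with t ht
    exact h1 t (le_of_lt ht)
  rw [hev.deriv_eq, deriv_const]

include h2 in
/-- The derivative of a radial profile vanishes on `(2, ∞)` (where it is constant). [folklore] -/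
theorem deriv_radialProfile_eq_zero_of_two_lt {s : ℝ} (hs : 2 < s) : deriv χ s = 0 := by
  have hev : χ =ᶠ[𝓝 s] fun _ ↦ 0 := by
    filter_upwards [Ioi_mem_nhds hs] with t ht
    exact h2 t (le_of_lt ht)
  rw [hev.deriv_eq, deriv_const]

include hχ h1 h2 in
/-- **The derivative of a radial profile is bounded**: `|χ'| ≤ C₁` on `ℝ` (it is continuous and
vanishes off `[1, 2]`). [folklore] -/
theorem exists_bound_deriv_radialProfile : ∃ C₁ : ℝ, 0 ≤ C₁ ∧ ∀ s, |deriv χ s| ≤ C₁ := by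
  have hc : Continuous (deriv χ) := hχ.continuous_deriv (by simp)
  obtain ⟨C, hC⟩ := isCompact_Icc.exists_bound_of_continuousOn (s := Icc (1 : ℝ) 2) hc.continuousOn
  refine ⟨max C 0, le_max_right _ _, fun s ↦ ?_⟩
  by_cases hs1 : s < 1
  · rw [deriv_radialProfile_eq_zero_of_lt_one h1 hs1, abs_zero]
    exact le_max_right _ _
  by_cases hs2 : 2 < s
  · rw [deriv_radialProfile_eq_zero_of_two_lt h2 hs2, abs_zero]
    exact le_max_right _ _
  · have hs : s ∈ Icc (1 : ℝ) 2 := ⟨not_lt.1 hs1, not_lt.1 hs2⟩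
    exact ((Real.norm_eq_abs _).symm.le.trans (hC s hs)).trans (le_max_left _ _)

variable {F : Type*} [NormedAddCommGroup F] [InnerProductSpace ℝ F]

omit [InnerProductSpace ℝ F] in
include h1 in
/-- Near the origin (on the open ball `‖y‖ < ρ`) the radial cut-off `χ(‖y‖/ρ)` is identically
`1`. [folklore] -/
theorem radialProfile_norm_div_eventuallyEq_one [NormedSpace ℝ F] {ρ : ℝ} (hρ : 0 < ρ) {y : F} (hy : ‖y‖ < ρ) :
    (fun y : F ↦ χ (‖y‖ / ρ)) =ᶠ[𝓝 y] fun _ ↦ 1 := by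
  filter_upwards [(isOpen_lt continuous_norm continuous_const).mem_nhds hy] with z hz
  exact h1 _ ((div_le_one hρ).2 (le_of_lt hz))

include hχ h1 in
/-- **The radial cut-off `y ↦ χ(‖y‖/ρ)` is smooth on the whole space** (`ρ > 0`): away from
the origin it is a composition of smooth maps, and on the ball `‖y‖ < ρ` it is constant.
[folklore] -/
theorem contDiff_radialProfile_norm_div {ρ : ℝ} (hρ : 0 < ρ) :
    ContDiff ℝ ∞ fun y : F ↦ χ (‖y‖ / ρ) := by
  rw [contDiff_iff_contDiffAt]
  intro y
  by_cases hy : y = 0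
  · subst hy
    exact contDiffAt_const.congr_of_eventuallyEq
      (radialProfile_norm_div_eventuallyEq_one h1 hρ (by simp [hρ]))
  · exact hχ.contDiffAt.comp y ((contDiffAt_norm ℝ hy).div_const ρ)

include hχ in
/-- **The derivative of the radial cut-off** away from the origin:
`D(χ(‖·‖/ρ))(y) w = χ'(‖y‖/ρ) ρ⁻¹ ⟪y, w⟫ / ‖y‖` (chain rule with `D‖·‖(y) = ⟪y, ·⟫/‖y‖`).
[folklore] -/
theorem fderiv_radialProfile_norm_div {ρ : ℝ} {y : F} (hy : y ≠ 0) (w : F) :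
    fderiv ℝ (fun y : F ↦ χ (‖y‖ / ρ)) y w = deriv χ (‖y‖ / ρ) / ρ * (⟪y, w⟫ / ‖y‖) := by
  have hn : HasFDerivAt (fun y : F ↦ ‖y‖) (‖y‖⁻¹ • innerSL ℝ y) y :=
    hasFDerivAt_norm_of_ne_zero hy
  have hd : HasFDerivAt (fun y : F ↦ ‖y‖ / ρ) (ρ⁻¹ • (‖y‖⁻¹ • innerSL ℝ y)) y := by
    have := hn.mul_const ρ⁻¹
    simp only [div_eq_mul_inv]
    convert this using 1
  have hχd : HasDerivAt χ (deriv χ (‖y‖ / ρ)) (‖y‖ / ρ) :=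
    (hχ.differentiable (by simp) _).hasDerivAt
  have hcomp := hχd.comp_hasFDerivAt y hd
  rw [show (fun y : F ↦ χ (‖y‖ / ρ)) = χ ∘ fun y : F ↦ ‖y‖ / ρ from rfl, hcomp.fderiv]
  simp only [FunLike.coe_smul, Pi.smul_apply, innerSL_apply_apply, smul_eq_mul]
  ring

include h1 in
/-- The radial cut-off `χ(‖y‖/ρ)` at the origin has derivative `0`. [folklore] -/
theorem fderiv_radialProfile_norm_div_zero {ρ : ℝ} (hρ : 0 < ρ) :
    fderiv ℝ (fun y : F ↦ χ (‖y‖ / ρ)) 0 = 0 := by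
  rw [(radialProfile_norm_div_eventuallyEq_one h1 hρ (y := (0 : F)) (by simp [hρ])).fderiv_eq]
  exact fderiv_const_apply _

include hχ h1 in
/-- **The derivative of the radial cut-off is `O(1/ρ)`**: if `|χ'| ≤ C₁` then
`‖D(χ(‖·‖/ρ))(y)‖ ≤ C₁/ρ` everywhere (`ρ > 0`). [folklore] -/
theorem norm_fderiv_radialProfile_norm_div_le {C₁ : ℝ} (hC₀ : 0 ≤ C₁) (hC : ∀ s, |deriv χ s| ≤ C₁)
    {ρ : ℝ} (hρ : 0 < ρ) (y : F) :
    ‖fderiv ℝ (fun y : F ↦ χ (‖y‖ / ρ)) y‖ ≤ C₁ / ρ := by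
  by_cases hy : y = 0
  · subst hy
    rw [fderiv_radialProfile_norm_div_zero h1 hρ, norm_zero]
    positivity
  · refine ContinuousLinearMap.opNorm_le_bound _ (by positivity) fun w ↦ ?_
    rw [fderiv_radialProfile_norm_div hχ hy, Real.norm_eq_abs, abs_mul, abs_div, abs_div]
    have hyn : 0 < ‖y‖ := norm_pos_iff.2 hy
    have hcs : |⟪y, w⟫| ≤ ‖y‖ * ‖w‖ := abs_real_inner_le_norm y w
    have h3 : |⟪y, w⟫| / |‖y‖| ≤ ‖w‖ := by
      rw [abs_of_pos hyn, div_le_iff₀ hyn]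
      linarith [mul_comm ‖y‖ ‖w‖]
    calc |deriv χ (‖y‖ / ρ)| / |ρ| * (|⟪y, w⟫| / |‖y‖|)
        ≤ C₁ / ρ * ‖w‖ := by
          rw [abs_of_pos hρ]
          exact mul_le_mul (div_le_div_of_nonneg_right (hC _) hρ.le) h3 (by positivity)
            (by positivity)

include h1 h2 in
/-- Off the closed annulus `ρ ≤ ‖y‖ ≤ 2ρ` the radial cut-off is locally constant, so its
derivative vanishes. [folklore] -/
theorem fderiv_radialProfile_norm_div_eq_zero {ρ : ℝ} (hρ : 0 < ρ) {y : F}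
    (hy : ‖y‖ < ρ ∨ 2 * ρ < ‖y‖) : fderiv ℝ (fun y : F ↦ χ (‖y‖ / ρ)) y = 0 := by
  rcases hy with hy | hy
  · rw [(radialProfile_norm_div_eventuallyEq_one h1 hρ hy).fderiv_eq]
    exact fderiv_const_apply _
  · have hev : (fun y : F ↦ χ (‖y‖ / ρ)) =ᶠ[𝓝 y] fun _ ↦ 0 := by
      filter_upwards [(isOpen_lt continuous_const continuous_norm).mem_nhds hy] with z hz
      exact h2 _ ((le_div_iff₀ hρ).2 (by linarith))
    rw [hev.fderiv_eq]
    exact fderiv_const_apply _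

end Profile

/-! ### Radial cut-offs on the manifold -/

namespace AFEnd

variable {X : Type} [TopologicalSpace X] [ChartedSpace E3 X] (e : AFEnd X)
  {χ : ℝ → ℝ}

/-- Off the end, `coord` is the junk value `0`. [folklore] -/
private theorem coord_of_not_mem' {q : X} (hq : q ∉ e.U) : e.coord q = 0 := by
  classical
  exact dif_neg hq

/-- The closed far piece `{q ∈ U | ρ ≤ ‖coord q‖}` of the end, through `coord`. [folklore] -/
private theorem mem_closedFar_iff {ρ : ℝ} {q : X} :
    q ∈ ((↑) : e.U → X) '' (e.chart ⁻¹' {x | ρ ≤ ‖(x : E3)‖}) ↔ ∃ _ : q ∈ e.U, ρ ≤ ‖e.coord q‖ := by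
  constructor
  · rintro ⟨u, hu, rfl⟩
    refine ⟨u.2, ?_⟩
    rw [e.coord_of_mem u.2]
    simpa using hu
  · rintro ⟨hq, hR⟩
    refine ⟨⟨q, hq⟩, ?_, rfl⟩
    rw [e.coord_of_mem hq] at hR
    simpa using hR

/-- The radial cut-off `χ(‖coord q‖/ρ)` equals `1` where `‖coord q‖ ≤ ρ` (`ρ > 0`), in particular
off the end (`coord = 0`). [folklore] -/
theorem radialCutoff_eq_one (h1 : ∀ s, s ≤ 1 → χ s = 1) {ρ : ℝ} (hρ : 0 < ρ) {q : X}
    (hq : ‖e.coord q‖ ≤ ρ) : χ (‖e.coord q‖ / ρ) = 1 :=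
  h1 _ ((div_le_one hρ).2 hq)

/-- The radial cut-off vanishes on the far region `far (2ρ)`. [folklore] -/
theorem radialCutoff_eq_zero_of_mem_far (h2 : ∀ s, 2 ≤ s → χ s = 0) {ρ : ℝ} (hρ : 0 < ρ) {q : X}
    (hq : q ∈ e.far (2 * ρ)) : χ (‖e.coord q‖ / ρ) = 0 := by
  obtain ⟨-, hq⟩ := e.mem_far_iff_coord.1 hq
  exact h2 _ ((le_div_iff₀ hρ).2 (by linarith))

/-- **Off the closed far piece `{q ∈ U | ρ ≤ ‖coord q‖}` the radial cut-off is locally `1`**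
(the piece is closed in `X` by the end axiom `isClosed_far`, `ρ > R`, and on its open complement
`‖coord‖ < ρ` or `coord = 0`). [folklore] -/
theorem radialCutoff_eventuallyEq_one (h1 : ∀ s, s ≤ 1 → χ s = 1) {ρ : ℝ} (hρ : e.R < ρ) {q : X}
    (hq : q ∉ ((↑) : e.U → X) '' (e.chart ⁻¹' {x | ρ ≤ ‖(x : E3)‖})) :
    (fun q ↦ χ (‖e.coord q‖ / ρ)) =ᶠ[𝓝 q] fun _ ↦ 1 := by
  have hρ0 : 0 < ρ := e.R_pos.trans hρ
  refine Filter.eventuallyEq_of_mem ((e.isClosed_far ρ hρ).isOpen_compl.mem_nhds hq)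
    fun p hp ↦ e.radialCutoff_eq_one h1 hρ0 ?_
  rw [mem_compl_iff, e.mem_closedFar_iff, not_exists] at hp
  by_cases hpU : p ∈ e.U
  · exact le_of_lt (not_le.1 (hp hpU))
  · rw [e.coord_of_not_mem' hpU, norm_zero]
    exact hρ0.le

/-- A point outside the far region `far R₁`, `R₁ < ρ`, lies outside the closed far piece
`{ρ ≤ ‖coord‖}`. [folklore] -/
theorem not_mem_closedFar_of_not_mem_far {R₁ ρ : ℝ} (hR₁ : R₁ < ρ) {q : X} (hq : q ∉ e.far R₁) :
    q ∉ ((↑) : e.U → X) '' (e.chart ⁻¹' {x | ρ ≤ ‖(x : E3)‖}) := by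
  intro hmem
  obtain ⟨hqU, hρq⟩ := e.mem_closedFar_iff.1 hmem
  exact hq (e.mem_far_iff_coord.2 ⟨hqU, hR₁.trans_le hρq⟩)

/-- **The radial cut-off is smooth on `X`** (`ρ > R`, `χ` smooth with `χ = 1` on `(−∞, 1]`): on
the end it is the smooth function `χ(‖·‖/ρ)` of the smooth coordinate map, and off the closed far
piece it is locally `1`. [folklore] -/
theorem contMDiff_radialCutoff (hχ : ContDiff ℝ ∞ χ) (h1 : ∀ s, s ≤ 1 → χ s = 1) {ρ : ℝ}
    (hρ : e.R < ρ) : ContMDiff (𝓡 3) 𝓘(ℝ, ℝ) ∞ (fun q ↦ χ (‖e.coord q‖ / ρ)) := fun q ↦ by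
  by_cases hq : q ∈ ((↑) : e.U → X) '' (e.chart ⁻¹' {x | ρ ≤ ‖(x : E3)‖})
  · obtain ⟨hqU, -⟩ := e.mem_closedFar_iff.1 hq
    exact (contDiff_radialProfile_norm_div hχ h1 (e.R_pos.trans hρ)).contDiffAt.comp_contMDiffAt
      (e.contMDiffAt_coord hqU)
  · exact contMDiffAt_const.congr_of_eventuallyEq (e.radialCutoff_eventuallyEq_one h1 hρ hq)

/-- The differential of the radial cut-off vanishes off the closed far piece `{ρ ≤ ‖coord‖}`.
[folklore] -/
theorem mvfderiv_radialCutoff_eq_zero (h1 : ∀ s, s ≤ 1 → χ s = 1) {ρ : ℝ} (hρ : e.R < ρ) {q : X}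
    (hq : q ∉ ((↑) : e.U → X) '' (e.chart ⁻¹' {x | ρ ≤ ‖(x : E3)‖})) :
    mvfderiv (𝓡 3) (fun q ↦ χ (‖e.coord q‖ / ρ)) q = 0 := by
  have h0 : mfderiv (𝓡 3) 𝓘(ℝ, ℝ) (fun q ↦ χ (‖e.coord q‖ / ρ)) q = 0 := by
    rw [(e.radialCutoff_eventuallyEq_one h1 hρ hq).mfderiv_eq]
    exact mfderiv_const
  ext v
  simp [mvfderiv, h0]

/-- **The radial cut-off read in the chart of the end** is the Euclidean radial cut-off:
`χ_ρ(Φ z) = χ(‖z‖/ρ)` for `R < ‖z‖`. [folklore] -/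
theorem endValue_radialCutoff (ρ : ℝ) {z : E3} (hz : e.R < ‖z‖) :
    endValue e (fun q ↦ χ (‖e.coord q‖ / ρ)) z = χ (‖z‖ / ρ) := by
  rw [endValue_of_lt e _ hz, e.coord_dataChart]

/-- For each point `q`, `χ_ρ(q) = 1` for all large `ρ`. [folklore] -/
theorem eventually_radialCutoff_eq_one (h1 : ∀ s, s ≤ 1 → χ s = 1) (q : X) :
    ∀ᶠ ρ : ℝ in atTop, χ (‖e.coord q‖ / ρ) = 1 := by
  filter_upwards [eventually_ge_atTop ‖e.coord q‖, eventually_gt_atTop (0 : ℝ)] with ρ hρ hρ0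
  exact e.radialCutoff_eq_one h1 hρ0 hρ

/-- **On a one-ended manifold the radial cut-offs have compact support**: `χ_ρ` vanishes on
`far (2ρ)` (`ρ > 0`), whose complement is contained in a compact set
(`IsSoleEnd.exists_isCompact_cover`). [folklore] -/
theorem hasCompactSupport_radialCutoff [T2Space X] (h2 : ∀ s, 2 ≤ s → χ s = 0)
    (hsole : e.IsSoleEnd) {ρ : ℝ} (hρ : 0 < ρ) :
    HasCompactSupport (fun q ↦ χ (‖e.coord q‖ / ρ)) := by
  obtain ⟨K, hK, hcover⟩ := hsole.exists_isCompact_cover (2 * ρ)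
  refine HasCompactSupport.intro' hK hK.isClosed fun q hq ↦ ?_
  rcases hcover q with h | h
  · exact absurd h hq
  · exact e.radialCutoff_eq_zero_of_mem_far h2 hρ h

end AFEnd

end Literature.Geometry.Lorentzian

end
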